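/-
Copyright: statement-level skeleton of a published paper (lit-balaban cell, Phase-2 proof seat p37 gen 105). No claims beyond
what the kernel checks below.
-/
import Literature.MathematicalPhysics.QuantumFieldTheory.Balaban1983to89.B3OnePIBridge

/-!
# B3 — T. Bałaban, *(Higgs)₂,₃ quantum fields in a finite volume. III. Renormalization*, CMP **88** (1983) 411–445
[Balaban1983Higgs3] — p. 416 [PDF 6] (1.21): the separating lines of a connected graph of the model are LINEARLY ORDERED — for two
distinct internal lines each of whose cut separates the vertex `i` from the vertex `j`, the two "sides of `i`" are STRICTLY NESTED.
With the bridge lemma (`B3OnePIBridge`) this is the graph-theoretic content of the chain structure «a connected two-leg graph is a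
CHAIN of proper (one-particle-irreducible in the channel) pieces joined by single lines», which (1.21) resums

statement-level skeleton of published theorems with citation tags; proofs where landed; nothing here is a claim about
the Yang–Mills mass gap

PDF held: `paper:balaban1983-higgs-2-3-quantum-fields-finite-volume` (journal page = PDF page + 410); p. 416 read in the text layer
(`p0006.txt` of `lit read`) and on the ×2 render `run/shared/lean/pub/pub-balaban/b2b-balaban-ref1/pages/1983-cmp88-higgs23-III/
1983-cmp88-higgs23-III-p006-x2.png`.

CITATION HEADER (lean-in-tree rule).  lit-balaban TYPED SKELETON (HOME `run/shared/lean/pub/lit-balaban/`), PHASE 2, seat p37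
gen 105 (unit `lit-balaban-p37`), fourth file of BRICK 3 of the owner r15's HQ25 programme for row **B3.Eq1.19-1.22** (fold owner
r15; lead g12 HEAD WORD Q25 2026-08-23T08:24:18Z: bricks welcome as located members, zero head weight).  Sibling of `B3OnePIGraphs`
(`Adj`, `AdjOff`, `IsConnected`), `B3OnePIPictureCensus`, `B3OnePIBridge` (`adj_cases`, `reach_cases`, `sides_of_separates`,
`other_line_same_side`, `side_total`).  p32 g41's BRICK 2 `B3Eq121OnePIChains` indexes connected two-leg graphs as LISTS of 1PI
insertions; the list order is, on the model, the nesting proved here.  REUSED BY NAME, nothing re-declared.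

THE PRINTED TEXT (verbatim).  p. 416: *"The function G^ε has a perturbative expansion of the following structure
G^ε = Σ_{n=0}^∞ C₀^ε[(−δm² + Σ^ε + ∂^{ε*}Σ₁^ε + Σ₁^{ε*}∂^ε + ∂^{ε*}Σ₂^ε∂^ε)C₀^ε]ⁿ, (1.21) where … Σ^ε, Σ₁^ε, Σ₂^ε are given by amputated,
one-particle-irreducible graphs of the expansion of G^ε."*  (Print states the chain structure without proof; this file proves the
ordering lemma it rests on, for the model's graphs.)

WHAT IS PROVED (theorems only; no definition, no `Prop` fact, no `sorry`; standard axioms).  Notation of the docstrings: ℓ = the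
line through the leg `c` (other leg `c′`), ℓ′ = the line through `d` (other leg `d′`), "side of `i` w.r.t. ℓ" = the vertices `v` with
`ReflTransGen (AdjOff G c) i v`.
* `adjOff_cases` / `reachOff_cases` ("first use of ℓ′ along a path avoiding ℓ"): a path avoiding ℓ either avoids ℓ′ as well (step by
  step) or brings its start to an endpoint of ℓ′ by steps avoiding both;
* **`side_subset_of_endpoints_outside`**: if the endpoints of a line ℓ′ lie OFF the side of `i` w.r.t. ℓ, then the side of `i`
  w.r.t. ℓ is contained in the side of `i` w.r.t. ℓ′;
* **`sides_nested`**: for `G` connected and two DISTINCT lines ℓ, ℓ′ both separating `i` from `j`, the side of `i` w.r.t. ℓ is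
  contained in the side of `i` w.r.t. ℓ′ or vice versa (the separating lines are totally ordered along the channel from `i` to `j`);
* **`sides_nested_strict`**: … and the containment is strict (the far endpoint of the inner line lies in the outer side only).
HONEST SCOPE.  The pieces between consecutive separating lines as sub-graph objects, and the converse gluing, are NOT
constructed; nothing analytic.
-/

namespace Literature.MathematicalPhysics.QuantumFieldTheory.Balaban1983to89.B3OnePIBridgeOrder

open Relation B3Prop1 B3Cor23Concrete B3OnePIGraphs B3OnePIBridge

variable {nbar : ℕ} {G : Graph nbar}

/-! ## §1 First use of a second line along a path avoiding the first -/

/-- kernel: a step avoiding the line ℓ (through `c`) either avoids the line ℓ′ (through `d`) as well, or it IS ℓ′ — then both its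
vertices are endpoints of ℓ′. [cite: Balaban1983Higgs3, (1.21) p.416] -/
theorem adjOff_cases {c d : Leg G.kind} {u v : Fin G.nV} (h : AdjOff G c u v) :
    (AdjOff G c u v ∧ AdjOff G d u v) ∨
      ((u = d.1 ∨ (G.other d).map Sigma.fst = some u) ∧ (v = d.1 ∨ (G.other d).map Sigma.fst = some v)) := by
  obtain ⟨x, y, hxy, hxc, hyc, hx, hy⟩ := adjOffOf_iff.1 h
  by_cases hxd : x = d
  · subst hxd
    exact Or.inr ⟨Or.inl hx.symm, Or.inr (by simp [hxy, hy])⟩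
  by_cases hyd : y = d
  · subst hyd
    have hdx : G.other y = some x := G.other_symm _ _ hxy
    exact Or.inr ⟨Or.inr (by simp [hdx, hx]), Or.inl hy.symm⟩
  exact Or.inl ⟨h, adjOffOf_iff.2 ⟨x, y, hxy, hxd, hyd, hx, hy⟩⟩

/-- kernel ("first use of ℓ′ along a path avoiding ℓ"): a path from `v` to `w` avoiding ℓ either avoids ℓ′ as well, step by step,
or it brings `v` to an endpoint of ℓ′ by steps avoiding both lines. [cite: Balaban1983Higgs3, (1.21) p.416] -/
theorem reachOff_cases {c d : Leg G.kind} {v w : Fin G.nV} (h : ReflTransGen (AdjOff G c) v w) :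
    ReflTransGen (fun a b => AdjOff G c a b ∧ AdjOff G d a b) v w ∨
      ∃ e, (e = d.1 ∨ (G.other d).map Sigma.fst = some e) ∧
        ReflTransGen (fun a b => AdjOff G c a b ∧ AdjOff G d a b) v e := by
  induction h with
  | refl => exact Or.inl ReflTransGen.refl
  | tail _ huw ih =>
      rcases ih with hvu | ⟨e, he, hve⟩
      · rcases adjOff_cases (d := d) huw with h' | ⟨hu, _⟩
        · exact Or.inl (hvu.tail h')
        · exact Or.inr ⟨_, hu, hvu⟩
      · exact Or.inr ⟨e, he, hve⟩

/-- kernel: a path avoiding both lines avoids each. [cite: Balaban1983Higgs3, (1.21) p.416] -/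
theorem reflTransGen_of_both {c d : Leg G.kind} {v w : Fin G.nV}
    (h : ReflTransGen (fun a b => AdjOff G c a b ∧ AdjOff G d a b) v w) :
    ReflTransGen (AdjOff G c) v w ∧ ReflTransGen (AdjOff G d) v w := by
  induction h with
  | refl => exact ⟨ReflTransGen.refl, ReflTransGen.refl⟩
  | tail _ hab ih => exact ⟨ih.1.tail hab.1, ih.2.tail hab.2⟩

/-! ## §2 The sides of `i` with respect to two separating lines are nested -/

/-- **containment from the position of the endpoints**: let ℓ be the line through `c`, `i` a vertex, and ℓ′ = {d, d′} an internal
line whose two endpoints lie OFF the side of `i` w.r.t. ℓ.  Then the side of `i` w.r.t. ℓ is contained in the side of `i` w.r.t. ℓ′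
(a path from `i` avoiding ℓ never meets ℓ′, so it avoids ℓ′ too). [cite: Balaban1983Higgs3, (1.21) p.416] -/
theorem side_subset_of_endpoints_outside {c d d' : Leg G.kind} (hd : G.other d = some d') {i : Fin G.nV}
    (hd1 : ¬ ReflTransGen (AdjOff G c) i d.1) (hd2 : ¬ ReflTransGen (AdjOff G c) i d'.1) {v : Fin G.nV}
    (hv : ReflTransGen (AdjOff G c) i v) : ReflTransGen (AdjOff G d) i v := by
  rcases reachOff_cases (d := d) hv with h | ⟨e, he, hie⟩
  · exact (reflTransGen_of_both h).2
  · exfalso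
    have hie' := (reflTransGen_of_both hie).1
    rw [isEndpoint_iff hd] at he
    rcases he with rfl | rfl
    · exact hd1 hie'
    · exact hd2 hie'

/-- **the separating lines are totally ordered**: for `G` connected and two DISTINCT internal lines ℓ = {c, c′}, ℓ′ = {d, d′} each
of whose cut separates `i` from `j`, the side of `i` w.r.t. ℓ is contained in the side of `i` w.r.t. ℓ′, or conversely.
[cite: Balaban1983Higgs3, (1.21) p.416] -/
theorem sides_nested (hG : IsConnected G) {c c' d d' : Leg G.kind} (hc : G.other c = some c') (hd : G.other d = some d')
    (hdc : d ≠ c) (hdc' : d ≠ c') {i j : Fin G.nV} (hsc : ¬ ReflTransGen (AdjOff G c) i j)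
    (hsd : ¬ ReflTransGen (AdjOff G d) i j) :
    (∀ v, ReflTransGen (AdjOff G c) i v → ReflTransGen (AdjOff G d) i v) ∨
    (∀ v, ReflTransGen (AdjOff G d) i v → ReflTransGen (AdjOff G c) i v) := by
  -- the legs of ℓ are not legs of ℓ′ either
  have hcd : c ≠ d := fun h => hdc h.symm
  have hcd' : c ≠ d' := by
    rintro rfl
    have := G.other_symm _ _ hd
    rw [hc] at this
    exact hdc' (Option.some.inj this).symm
  -- where do the endpoints of ℓ′ sit w.r.t. ℓ, and those of ℓ w.r.t. ℓ′?  (both endpoints of a line are on one side)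
  have sameD := other_line_same_side (G := G) hc (i := i) hd hdc hdc'
  have sameC := other_line_same_side (G := G) hd (i := i) hc hcd hcd'
  by_cases hD : ReflTransGen (AdjOff G c) i d.1
  · by_cases hC : ReflTransGen (AdjOff G d) i c.1
    · -- both "inside": impossible
      exfalso
      -- the far endpoint f′ of ℓ′ w.r.t. its own cut
      rcases sides_of_separates hG hd hsd with ⟨_, hfj, hfi⟩ | ⟨_, hfj, hfi⟩
      · -- far endpoint of ℓ′ is d′.1: it lies on the i-side of ℓ (sameD), joined to j avoiding ℓ′
        have hf_c : ReflTransGen (AdjOff G c) i d'.1 := sameD.1 hD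
        rcases reachOff_cases (d := c) hfj with h | ⟨e, he, hfe⟩
        · exact hsc (hf_c.trans (reflTransGen_of_both h).2)
        · have hfe' := (reflTransGen_of_both hfe).1  -- avoiding ℓ′ : ReflTransGen (AdjOff G d) d'.1 e
          rw [isEndpoint_iff hc] at he
          have heC : ReflTransGen (AdjOff G d) i e := by
            rcases he with rfl | rfl
            · exact hC
            · exact sameC.1 hC
          exact hfi (heC.trans (reflTransGen_adjOff_symm hfe'))
      · have hf_c : ReflTransGen (AdjOff G c) i d.1 := hD
        rcases reachOff_cases (d := c) hfj with h | ⟨e, he, hfe⟩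
        · exact hsc (hf_c.trans (reflTransGen_of_both h).2)
        · have hfe' := (reflTransGen_of_both hfe).1
          rw [isEndpoint_iff hc] at he
          have heC : ReflTransGen (AdjOff G d) i e := by
            rcases he with rfl | rfl
            · exact hC
            · exact sameC.1 hC
          exact hfi (heC.trans (reflTransGen_adjOff_symm hfe'))
    · -- endpoints of ℓ OFF the i-side of ℓ′: side w.r.t. ℓ′ ⊆ side w.r.t. ℓ
      have hC' : ¬ ReflTransGen (AdjOff G d) i c'.1 := fun h => hC (sameC.2 h)
      exact Or.inr fun v hv => side_subset_of_endpoints_outside hc hC hC' hv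
  · -- endpoints of ℓ′ OFF the i-side of ℓ: side w.r.t. ℓ ⊆ side w.r.t. ℓ′
    have hD' : ¬ ReflTransGen (AdjOff G c) i d'.1 := fun h => hD (sameD.2 h)
    exact Or.inl fun v hv => side_subset_of_endpoints_outside hd hD hD' hv

/-- **strict nesting**: in the situation of `sides_nested`, if the side of `i` w.r.t. ℓ is contained in the side w.r.t. ℓ′, then
some vertex — the far endpoint of ℓ — lies in the side w.r.t. ℓ′ but not in the side w.r.t. ℓ (the two sides differ: distinct
separating lines sit at distinct positions along the channel). [cite: Balaban1983Higgs3, (1.21) p.416] -/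
theorem sides_nested_strict (hG : IsConnected G) {c c' d d' : Leg G.kind} (hc : G.other c = some c') (hd : G.other d = some d')
    (hdc : d ≠ c) (hdc' : d ≠ c') {i j : Fin G.nV} (hsc : ¬ ReflTransGen (AdjOff G c) i j)
    (hsub : ∀ v, ReflTransGen (AdjOff G c) i v → ReflTransGen (AdjOff G d) i v) :
    ∃ v, ReflTransGen (AdjOff G d) i v ∧ ¬ ReflTransGen (AdjOff G c) i v := by
  have hcd : c ≠ d := fun h => hdc h.symm
  have hcd' : c ≠ d' := by
    rintro rfl
    have := G.other_symm _ _ hd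
    rw [hc] at this
    exact hdc' (Option.some.inj this).symm
  -- ℓ is a line other than ℓ′: its endpoints are adjacent avoiding ℓ′
  have sameC := other_line_same_side (G := G) hd (i := i) hc hcd hcd'
  rcases sides_of_separates hG hc hsc with ⟨hnear, _, hfar⟩ | ⟨hnear, _, hfar⟩
  · exact ⟨c'.1, sameC.1 (hsub _ hnear), hfar⟩
  · exact ⟨c.1, sameC.2 (hsub _ hnear), hfar⟩

end Literature.MathematicalPhysics.QuantumFieldTheory.Balaban1983to89.B3OnePIBridgeOrder
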